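import Summits.Ventures.Crystal3D.Theorems.StickyWulffConstantTextureLiminfTexShadowEdgeOnSepCells
import HarnessLib

/-!
# TexShadow row (e) / EDGE-ON residual F_A: the TERRACE CENSUS vocabulary (mechanism (β), cf-p1 RULING (ccxxv)(3); 19480-p1 g17 memo LAMELLA-CENSUS-g17.md)

HONEST FRAMING. Venture `Summits/Ventures/Crystal3D` (cell `crystal3d-full`), route `route-Ventures-StickyWulffConstant`, helper for the law-v5 crux
`TextureLiminfV5` (stmt-Ventures-23912), lane T, registered line `TexShadow` v8.13R, stubs `stub_edgeOnSep` / `stub_edgeOnRead` / `stub_edgeOnRowRead`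
(their irreducible residual F_A, memo SEP-CELLS-g17 rev 2).  DEFINITIONS + glue only; NO census is proved; NOTHING is asserted; F-C1 not moved.

THE POINT.  The census (memo §0–§2) bounds the `BilayerWallAt` functional of ANY filling between two Barlow plates whose bilayer lattices are related by
a reduced admissible twin word by `½ Σ_k sin θ_k`, `θ_k` the inclination of the chain's `k`-th twin plane to the wall: saturated material is rigid (patches =
terraces of the chain's lattice planes), risers between terraces are off-plane facets of COAXIAL twin pairs priced by lane F's `½ sin`, and the projection
identity turns riser area into `A·sin θ_k`.  This file fixes the vocabulary so the target can be registered and consumed: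
* `censusSum B κ` — the census weight `½ Σ_k √(1 − ⟪B_k μ_k, e₃⟫²)` of a word `κ` of unit model normals read from the frame `B` IN CROSSING ORDER
  (first-crossed letter first; the frame advances `B ↦ R_μ ≫ B` after each letter, `twinFrame_eq_reflection_trans`); for a unit letter the summand is
  `½ sin ∠(B_k μ_k, e₃)`.  The tree's `wordFrame B κ` lists the LAST-crossed letter first, so the census of the pair `P₂·Λ₀ = (wordFrame P₁ κ)·Λ₀` is
  `censusSum P₁ κ.reverse`.
* `CensusDominatedAt A₁ A₂ c` — the table `c` is dominated, pair by pair, by the census of EVERY reduced admissible word of length `≥ 2` relating the two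
  bilayer frames' lattices (by rigidity such words agree up to letter signs, so `∀` is the right quantifier; pairs related by NO such word — coaxial pairs,
  length `≤ 1`, and generic pairs — are unconstrained here and stay with lanes F / G).
* `TerraceCensusAt C R₀` — THE TARGET: every Hägg pair of presented plates with bilayer frames and a census-dominated admissible table satisfies the cell
  inequality `BilayerWallAt C R₀`.  (The memo's constant: at the F_A views every word has census `≥ 0.61 > 13/25`, so a `(13/25)`-capped table is
  census-dominated there — that inclusion is a finite certified table, NOT part of this file.)
* glue `faultedOnAt_of_terraceCensus` / `coreOn_of_terraceCensus`: the target gives the whole cell law, hence the residual core, on the regime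
  `CensusRegimeAt c₀` := «every `c₀`-capped admissible table is census-dominated», for any class `X` — the shape in which `stub_edgeOnRead/RowRead/Sep`
  restricted to F_A would be DERIVED once `TerraceCensusAt` is proved and `F_A ⊆ CensusRegimeAt (13/25)` is certified.
WHAT THIS IS NOT: the census theorem; the B-table; any claim about lane F's locality (the sizing question of the memo); F-C1 not moved.
-/

noncomputable section

open scoped BigOperators InnerProductSpace ENNReal
open MeasureTheory Filter

namespace Summit.Ventures.Crystal3D.Cruxes.TextureLiminf.TexShadow

open Summit.Ventures.Crystal3D Summit.Ventures.Crystal3D.Theorems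
open Literature.MathematicalPhysics.StatisticalMechanics (IsHaggSeq fccStacking barlowStacking basalMirror)

/-! ## The census weight of a word -/

/-- **Census weight of a word of model normals read from the frame `B` in CROSSING ORDER**: `½ √(1 − ⟪B μ, e₃⟫²)` for the first letter (`= ½ sin` of
the inclination of the spatial plane normal `B μ` to the wall normal when `‖μ‖ = 1`), plus the census of the rest read from the twin frame `R_μ ≫ B`. -/
def censusSum : (E3 ≃ₗᵢ[ℝ] E3) → List E3 → ℝ
  | _, [] => 0
  | B, μ :: rest => 1 / 2 * Real.sqrt (1 - ⟪B μ, e₃⟫_ℝ ^ 2) + censusSum (((ℝ ∙ μ)ᗮ.reflection).trans B) rest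

/-- Unfolding, empty word. -/
@[simp] theorem censusSum_nil (B : E3 ≃ₗᵢ[ℝ] E3) : censusSum B [] = 0 := rfl

/-- Unfolding, one more letter. -/
@[simp] theorem censusSum_cons (B : E3 ≃ₗᵢ[ℝ] E3) (μ : E3) (rest : List E3) :
    censusSum B (μ :: rest) = 1 / 2 * Real.sqrt (1 - ⟪B μ, e₃⟫_ℝ ^ 2) + censusSum (((ℝ ∙ μ)ᗮ.reflection).trans B) rest := rfl

/-- The census weight is nonnegative. -/
theorem censusSum_nonneg : ∀ (B : E3 ≃ₗᵢ[ℝ] E3) (κ : List E3), 0 ≤ censusSum B κ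
  | _, [] => le_rfl
  | B, μ :: rest => by
    rw [censusSum_cons]
    exact add_nonneg (mul_nonneg (by norm_num) (Real.sqrt_nonneg _)) (censusSum_nonneg _ rest)

/-- Each letter contributes at most `½`: the census of a word is at most half its length. -/
theorem censusSum_le_half_length : ∀ (B : E3 ≃ₗᵢ[ℝ] E3) (κ : List E3), censusSum B κ ≤ 1 / 2 * κ.length
  | _, [] => by simp
  | B, μ :: rest => by
    rw [censusSum_cons, List.length_cons, Nat.cast_succ]
    have h1 : Real.sqrt (1 - ⟪B μ, e₃⟫_ℝ ^ 2) ≤ 1 :=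
      calc Real.sqrt (1 - ⟪B μ, e₃⟫_ℝ ^ 2) ≤ Real.sqrt 1 := Real.sqrt_le_sqrt (by nlinarith [sq_nonneg ⟪B μ, e₃⟫_ℝ])
        _ = 1 := Real.sqrt_one
    have h2 := censusSum_le_half_length (((ℝ ∙ μ)ᗮ.reflection).trans B) rest
    nlinarith

/-! ## Census-dominated tables and the target -/

/-- **The table `c` is CENSUS-DOMINATED for the bilayer frames `A₁`, `A₂`**: for every pair `(i, j)` and every reduced admissible word `κ` of length `≥ 2`
with `(A₂ j)·Λ₀ = (wordFrame (A₁ i) κ)·Λ₀`, the charge `c i j` is at most the census of `κ` read from `A₁ i` in crossing order. -/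
def CensusDominatedAt (A₁ A₂ : ℤ → (E3 ≃ₗᵢ[ℝ] E3)) (c : ℤ → ℤ → ℝ) : Prop :=
  ∀ i j : ℤ, ∀ κ : List E3,
    (∀ μ ∈ κ, ‖μ‖ = 1 ∧
      ∀ w ∈ fccSlots, ⟪w, μ⟫_ℝ = 0 ∨ ⟪w, μ⟫_ℝ = Real.sqrt (2 / 3) ∨ ⟪w, μ⟫_ℝ = -Real.sqrt (2 / 3)) →
    List.IsChain (fun μ μ' => ⟪μ, μ'⟫_ℝ = 1 / 3 ∨ ⟪μ, μ'⟫_ℝ = -1 / 3) κ →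
    2 ≤ κ.length →
    A₂ j '' fccStacking 1 (Real.sqrt (2 / 3)) = (wordFrame (A₁ i) κ) '' fccStacking 1 (Real.sqrt (2 / 3)) →
      c i j ≤ censusSum (A₁ i) κ.reverse

/-- **THE TERRACE CENSUS at constants `(C, R₀)`** (mechanism (β), TARGET — not proved here): every pair of Hägg words and presented plates with bilayer
frames, and every admissible table (at cap `1`) that is census-dominated, satisfies the wall cell inequality. -/
def TerraceCensusAt (C R₀ : ℝ) : Prop :=
  ∀ (σ₁ σ₂ : ℤ → ℤ), IsHaggSeq σ₁ → IsHaggSeq σ₂ →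
    ∀ (L₁ L₂ : E3 ≃ₗᵢ[ℝ] E3) (s₁ s₂ : E3) (A₁ A₂ : ℤ → (E3 ≃ₗᵢ[ℝ] E3)) (u₁ u₂ : ℤ → E3),
    BilayerFramesAt L₁ s₁ σ₁ A₁ u₁ → BilayerFramesAt L₂ s₂ σ₂ A₂ u₂ →
    ∀ (c : ℤ → ℤ → ℝ) (m : ℤ → ℤ → E3), BilayerChargeAdmissible A₁ A₂ c m → CensusDominatedAt A₁ A₂ c →
      BilayerWallAt C R₀ σ₁ σ₂ L₁ L₂ s₁ s₂ c

/-- **The census regime at cap `c₀`** (a property of the frame pair, through its bilayer frames): EVERY table admissible at cap `c₀` for ANY bilayer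
frames of the two presented plates is census-dominated — i.e. every relating word of length `≥ 2` has census `≥ c₀` (memo: F_A ⊆ this regime at
`c₀ = 13/25`, a finite certified table). -/
def CensusRegimeAt (c₀ : ℝ) (σ₁ σ₂ : ℤ → ℤ) (L₁ L₂ : E3 ≃ₗᵢ[ℝ] E3) : Prop :=
  ∀ (s₁ s₂ : E3) (A₁ A₂ : ℤ → (E3 ≃ₗᵢ[ℝ] E3)) (u₁ u₂ : ℤ → E3),
    BilayerFramesAt L₁ s₁ σ₁ A₁ u₁ → BilayerFramesAt L₂ s₂ σ₂ A₂ u₂ →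
    ∀ (c : ℤ → ℤ → ℝ) (m : ℤ → ℤ → E3), BilayerChargeAdmissibleAt c₀ A₁ A₂ c m → CensusDominatedAt A₁ A₂ c

/-! ## Glue: the census gives the cell law, hence the residual core, on its regime -/

/-- **The census gives the whole cell law on its regime** at every cap `c₀ ≤ 1`. -/
theorem faultedOnAt_of_terraceCensus {C R₀ c₀ : ℝ} (hc₀ : c₀ ≤ 1) (h : TerraceCensusAt C R₀) :
    BilayerWallFaultedOnAt (CensusRegimeAt c₀) c₀ C R₀ :=
  fun σ₁ σ₂ hσ₁ hσ₂ _ L₁ L₂ s₁ s₂ A₁ A₂ u₁ u₂ hA₁ hA₂ hreg c m hadm =>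
    h σ₁ σ₂ hσ₁ hσ₂ L₁ L₂ s₁ s₂ A₁ A₂ u₁ u₂ hA₁ hA₂ c m (bilayerChargeAdmissible_of_at hc₀ hadm)
      (hreg s₁ s₂ A₁ A₂ u₁ u₂ hA₁ hA₂ c m hadm)

/-- **The residual core on `X ∧ census regime`** from the census, at cap `13/25`, for ANY class `X` (the shape in which the F_A parts of
`stub_edgeOnSep` / `stub_edgeOnRead` / `stub_edgeOnRowRead` would be derived). -/
theorem coreOn_of_terraceCensus (X : (ℤ → ℤ) → (ℤ → ℤ) → (E3 ≃ₗᵢ[ℝ] E3) → (E3 ≃ₗᵢ[ℝ] E3) → Prop) {C R₀ : ℝ}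
    (h : TerraceCensusAt C R₀) :
    BilayerWallResidualFaultedCoreOnAt (fun σ₁ σ₂ L₁ L₂ => X σ₁ σ₂ L₁ L₂ ∧ CensusRegimeAt (13 / 25) σ₁ σ₂ L₁ L₂) (13 / 25) C R₀ :=
  residualFaultedCoreOnAt_anti (fun _ _ _ _ hx => hx.2)
    (residualFaultedCoreOnAt_of_faultedOnAt (faultedOnAt_of_terraceCensus (by norm_num) h))

/-- **Splitting a class stub along the census regime** (`R₀ = 10`): the census plus a registered remainder on `X ∧ ¬ CensusRegimeAt (13/25)` give
the core on `X`. -/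
theorem coreOn_of_terraceCensus_of_remainder (X : (ℤ → ℤ) → (ℤ → ℤ) → (E3 ≃ₗᵢ[ℝ] E3) → (E3 ≃ₗᵢ[ℝ] E3) → Prop) {C : ℝ}
    (h : TerraceCensusAt C 10)
    (hrem : ∃ C' : ℝ, BilayerWallResidualFaultedCoreOnAt
      (fun σ₁ σ₂ L₁ L₂ => X σ₁ σ₂ L₁ L₂ ∧ ¬ CensusRegimeAt (13 / 25) σ₁ σ₂ L₁ L₂) (13 / 25) C' 10) :
    ∃ C'' : ℝ, BilayerWallResidualFaultedCoreOnAt X (13 / 25) C'' 10 :=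
  coreOn_of_zones X (CensusRegimeAt (13 / 25)) ⟨C, coreOn_of_terraceCensus X h⟩ hrem

end Summit.Ventures.Crystal3D.Cruxes.TextureLiminf.TexShadow

end
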